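import Summits.BirchSwinnertonDyer.BirchSwinnertonDyer.Theorems.PrintCf2DisegniPairTwoChiLinePointwiseMinusEight
import Summits.BirchSwinnertonDyer.BirchSwinnertonDyer.Theorems.PrintCf2DisegniPairTwoChiLineFactorisationOdd
import Summits.BirchSwinnertonDyer.BirchSwinnertonDyer.Theorems.PrintCf2DisegniPairTwoChiLineFactorisation
import HarnessLib

/-!
# Road (C) `disegni-pair-two` on crux stmt-BirchSwinnertonDyer-20368 — the FACTORISATION on the
# `χ₋₈ ∘ N`-line at `p = 2` (`d* = −2`): Disegni's `2`-adic Rankin–Selberg function is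
# `c⁻ · L₂⁻(E, ω, −T−2) · L₂⁻(E^{(d_K)}, ω, −T−2)` — the ODD branches, REFLECTED variable

Cell `bsd-print-cf2`, width seat `bsd-line-cf2-p1-w8` g21; third factorisation of the road-(C) trio after
`…ChiLineFactorisation` (`d* = 2`: `G(T) = c·L₂(E,−T−2)·L₂(E′,−T−2)`, plus branches) and
`…ChiLineFactorisationOdd` (`d* = −1`: `G(T) = c⁻·L₂⁻(E,ω,T)·L₂⁻(E′,ω,T)`). THEOREMS ONLY (no `def`, no
named fact, no `sorry`); `--supports stmt-BirchSwinnertonDyer-20368`. BSD is not proved by any of this.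
For `ε₋₂ = χ₋₈ = χ₈·ω` the two mechanisms compose: the line character at `θ` is `(θχ₈)·ω ∘ N`, read on the
Mazur–Tate–Teitelbaum side by the ODD branch `L₂⁻(g, α, ω, ·) = padicLFunctionMinusBranch g α 1` at the
EVEN character `χ_{θχ₈}`, whose point is the `χ₈`-REFLECTION `−cycLinePoint ι θ − 2` (`cycLinePoint_mul_chi8`).

* `chi8'Line_eq_C_mul_map` — ★★★ **`G = c⁻ · H♯`** with `H ∈ ℚ₂⟦T⟧` the reflected re-centring of
  `P⁻ := L₂⁻(E,ω,T)·L₂⁻(E′,ω,T)`: `H(z) = P⁻(−2−z)` on the open disc, `H(0) = P⁻(−2)`, `[T¹]H = −P⁻′(−2)`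
  (`exists_recenter_sub`), `c⁻ = ι⁻¹(−u·Car·Ω⁻_f·Ω⁻_{f′})`; i.e. **`G(T) = c⁻·L₂⁻(E,ω,−T−2)·L₂⁻(E′,ω,−T−2)`**.

Proof (as for `d* = 2`): `D := G − c⁻·H♯` is bounded and vanishes at every point of the uniqueness
principle `eq_zero_of_bounded_of_forall_character_hasSum_zero`: levels `2`, `4` carry no even primitive
character; level `8` is `θ = χ₈`, point `−2`, where the line character is `χ₄∘N` and
`G(−2) = c⁻·L₂⁻(E,ω,0)·L₂⁻(E′,ω,0)` (`hasLineValueAt_chi8'Line_neg_two`,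
`constantCoeff_padicLFunctionMinusBranch_one_two_of_coeffField`, `ratMinusTwistedSymbolSum_twin_chi4`) while
`H(−2) = P⁻(0)`; level `2^{m+1} ≥ 16`: `G(pt θ) = c⁻·v(f)·v(f′)` (`hasLineValueAt_chi8'Line_of_three_le`)
with `v(g)` the odd-branch value at `χ_{θχ₈}` (`hasSum_padicLMinusBranchCoeff_mul_pow_of_isPrimitive`,
`sum_twin_mul_teichWeight_eq_ratMinusTwistedSymbolSum`, `χ₋₈ = χ₈χ₄`), point `−pt θ − 2`, while
`H(pt θ) = P⁻(−2−pt θ)`; constant term: `G(0) = c⁻·v₈(f)·v₈(f′)` (`hasLineValueAt_chi8'Line_zero`), the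
odd-branch values at `χ_{χ₈}` (`θχ₄ = χ₋₈` for `θ = χ₈`), point `−2`, while `H(0) = P⁻(−2)`.

Setting: `E = V/ℚ` globally minimal GOOD ORDINARY at `2` (newform `f`, `α = unitRoot V 2`), `K` quadratic,
`(2, d_K) = 1`, `2` split (`𝔭, 𝔭′ ∋ 2`), Kronecker character `κ_K`; `V′` globally minimal, good ordinary at
`2`, `a₂(V′) = a₂(V)`, newform `f′`, `a_n(f′) = κ_K(n)a_n(f)`; `G` Disegni's function on the line through
`χ₋₈∘N_{K/ℚ}` (`Disegni2017.ChiLineInterpolation`). For the crux: `E = 49a1^{(d′)}`, `d′ ≡ 1 (4)`,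
`W = E ⊗ χ₋₈ = 49a1^{(−2d′)}`.

References: [Disegni2017] Thm. A, Lemma 10.2.1–10.2.2 (arXiv v3 PDF pp. 6–8, 68); [MazurTateTeitelbaum1986Invent]
§I.8 (8.6), §I.10–I.14; [PerrinRiou1987] (1.1) (p. 459); [Robert2000] Ch. 6 §1.5; cell PREGRADE
`bsd-print-cf2-plan/PREGRADE-disegni-pair-two-skeleton-g24.md` §5.
-/

set_option autoImplicit false
set_option linter.dupNamespace false

noncomputable section

open scoped Classical MatrixGroups ModularForm NumberField

open CongruenceSubgroup NumberField IsDedekindDomain WeierstrassCurve Literature.NumberTheory.EllipticCurves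
  Literature.NumberTheory.EllipticCurves.ModularForms
  Literature.NumberTheory.EllipticCurves.Disegni2017 Literature.NumberTheory.GaloisRepresentations
  Summit.BirchSwinnertonDyer.Rank1Residual.Additive

namespace Summit.BirchSwinnertonDyer.BirchSwinnertonDyer.Theorems.PrintCf2.DisegniPairTwo

section FactorisationMinusEight

variable (ι : PadicAlgCl 2 ≃+* ℂ) (K : Type) [Field K] [NumberField K] [IsGalois ℚ K]

/-- `‖−2‖₂ = 1/2 < 1` in `ℚ₂`. [folklore] -/
private theorem norm_neg_two_lt_one'' : ‖(-2 : ℚ_[2])‖ < 1 := by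
  rw [norm_neg, show (2 : ℚ_[2]) = ((2 : ℕ) : ℚ_[2]) by norm_num, Padic.norm_p]
  norm_num

/-- `ι₂(−2) = −2`. [folklore] -/
private theorem algebraMap_neg_two'' : algebraMap ℚ_[2] ℂ_[2] (-2) = -2 := by
  rw [map_neg, map_ofNat]

/-- ★★★ **FACTORISATION of Disegni's `2`-adic Rankin–Selberg function on the `χ₋₈∘N`-line** (`d* = −2`
branch of road (C)). With the notation of the module docstring: there is `H ∈ ℚ₂⟦T⟧` with
(i) `G = c⁻ · H♯` in `ℂ₂⟦T⟧`; (ii) `H(0) = Σ_k P⁻_k(−2)^k = P⁻(−2)`; (iii) `[T¹]H = −Σ_k k·P⁻_k·(−2)^{k−1} =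
−P⁻′(−2)`; (iv) `Σ_j H_j z^j = Σ_k P⁻_k(−2−z)^k` for all `z ∈ ℂ₂`, `‖z‖ < 1` — where
`P⁻ = L₂⁻(E,ω,T)·L₂⁻(E′,ω,T) = padicLFunctionMinusBranch f α 1 · padicLFunctionMinusBranch f′ α 1`. That is,
**`G(T) = c⁻ · L₂⁻(E, ω, −T−2) · L₂⁻(E′, ω, −T−2)`**, `c⁻ = ι⁻¹(−u·Car·Ω⁻_f·Ω⁻_{f′})`: Disegni's function on
the line through `χ₋₈∘N` is the product of the two ODD-branch Mazur–Tate–Teitelbaum `2`-adic `L`-functions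
of `E` and `E^{(d_K)}` read on the `χ₈`-coset `T ↦ −T−2`. Proof: uniqueness of bounded interpolants over
`ℂ₂` (`eq_zero_of_bounded_of_forall_character_hasSum_zero`) applied to `G − c⁻·H♯`.
[cite: Disegni2017, Theorem A and Lemma 10.2.1–10.2.2 (arXiv v3 PDF pp. 6–8, 68)]
[cite: MazurTateTeitelbaum1986Invent, §I.10 (10.1)–(10.2), §I.11–I.14 (14.3)] [cite: PerrinRiou1987, (1.1) (p. 459)] -/
theorem chi8'Line_eq_C_mul_map (h2 : Module.finrank ℚ K = 2)
    (hsplit : ((Ideal.span {(2 : ℤ)}).primesOver (𝓞 K)).ncard = 2)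
    (𝔭 𝔭' : HeightOneSpectrum (𝓞 K)) (h𝔭 : ((2 : ℕ) : 𝓞 K) ∈ 𝔭.asIdeal)
    (h𝔭' : ((2 : ℕ) : 𝓞 K) ∈ 𝔭'.asIdeal)
    (κ : DirichletCharacter ℂ (NumberField.discr K).natAbs)
    (hκ : ∀ ℓ : ℕ, ℓ.Prime → ℓ ≠ 2 → κ ℓ = (jacobiSym (NumberField.discr K) ℓ : ℂ))
    (hκ2 : κ 2 = if NumberField.discr K % 8 = 1 then 1
        else if NumberField.discr K % 8 = 5 then -1 else 0)
    (hd : Nat.Coprime 2 (NumberField.discr K).natAbs)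
    (V V' : WeierstrassCurve ℚ) [V.IsElliptic] [V.IsGloballyMinimal] [V'.IsElliptic] [V'.IsGloballyMinimal]
    (hordV : IsOrdinaryAt V 2) (hordV' : IsOrdinaryAt V' 2) (hap : V'.frobeniusTrace 2 = V.frobeniusTrace 2)
    {N N' : ℕ} [NeZero N] [NeZero N'] {f : CuspForm (Gamma0 N) 2}
    {f' : CuspForm (Gamma0 N') 2} (hfV : IsNewformOf V f) (hfV' : IsNewformOf V' f')
    (hV' : ∀ n : ℕ, cuspCoeff f' n = κ (n : ZMod _) * cuspCoeff f n)
    {Car : ℝ} {G : PowerSeries ℂ_[2]}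
    (hG : ChiLineInterpolation ι K f (ι (((unitRoot V 2 : ℚ_[2]) : PadicAlgCl 2)))
      (baseChangeDirichlet K (ZMod.χ₈'.ringHomComp (Int.castRingHom ℂ))) 𝔭 𝔭' Car G) :
    ∃ H : PowerSeries ℚ_[2],
      G = PowerSeries.C
          (((ι.symm (-(splitLocalConstant 2 : ℂ) * (Car : ℂ) * (minusPeriod f : ℂ) * (minusPeriod f' : ℂ)) :
              PadicAlgCl 2) : ℂ_[2])) * PowerSeries.map (algebraMap ℚ_[2] ℂ_[2]) H ∧
      HasSum (fun k : ℕ ↦ PowerSeries.coeff k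
          (padicLFunctionMinusBranch f (unitRoot V 2 : ℚ_[2]) 1 *
            padicLFunctionMinusBranch f' (unitRoot V 2 : ℚ_[2]) 1) * (-2) ^ k) (PowerSeries.coeff 0 H) ∧
      HasSum (fun k : ℕ ↦ -(PowerSeries.coeff k
          (padicLFunctionMinusBranch f (unitRoot V 2 : ℚ_[2]) 1 *
            padicLFunctionMinusBranch f' (unitRoot V 2 : ℚ_[2]) 1) *
            (k : ℚ_[2]) * (-2) ^ (k - 1))) (PowerSeries.coeff 1 H) ∧
      ∀ z : ℂ_[2], ‖z‖ < 1 →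
        HasSum (fun j : ℕ ↦ algebraMap ℚ_[2] ℂ_[2] (PowerSeries.coeff j H) * z ^ j)
          (∑' k : ℕ, algebraMap ℚ_[2] ℂ_[2] (PowerSeries.coeff k
            (padicLFunctionMinusBranch f (unitRoot V 2 : ℚ_[2]) 1 *
              padicLFunctionMinusBranch f' (unitRoot V 2 : ℚ_[2]) 1)) * (-2 - z) ^ k) := by
  -- the unit root `α` (common to `V` and `V′`) and the minus Mazur–Swinnerton-Dyer measures
  obtain ⟨hαeq, hαu, hα0⟩ := unitRoot_coe_spec (W := V) hordV
  obtain ⟨hαeq', -, -⟩ := unitRoot_coe_spec (W := V') hordV'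
  have hα' : (unitRoot V' 2 : ℚ_[2]) = (unitRoot V 2 : ℚ_[2]) := by
    rw [show unitRoot V' 2 = unitRoot V 2 by unfold unitRoot; rw [hap]]
  rw [hα', hap] at hαeq'
  set α : ℚ_[2] := (unitRoot V 2 : ℚ_[2]) with hαdef
  set c : ℂ_[2] := ((ι.symm (-(splitLocalConstant 2 : ℂ) * (Car : ℂ) * (minusPeriod f : ℂ) *
    (minusPeriod f' : ℂ)) : PadicAlgCl 2) : ℂ_[2]) with hc
  set B₁ := padicLFunctionMinusBranch f α 1 with hB₁
  set B₂ := padicLFunctionMinusBranch f' α 1 with hB₂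
  set ι₂ := algebraMap ℚ_[2] ℂ_[2] with hι₂
  have hf : IsNewform0 f := hfV.1
  have hQ : coeffField f = ⊥ := hfV.coeffField_eq_bot
  have hf' : IsNewform0 f' := hfV'.1
  have hQ' : coeffField f' = ⊥ := hfV'.coeffField_eq_bot
  have hN : ¬ 2 ∣ N := not_dvd_level_of_isNewformOf hfV hordV.1
  have hN' : ¬ 2 ∣ N' := not_dvd_level_of_isNewformOf hfV' hordV'.1
  have hapf : cuspCoeff f 2 = ((V.frobeniusTrace 2 : ℤ) : ℂ) :=
    cuspCoeff_eq_frobeniusTrace_of_isNewformOf_holds hfV hordV.1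
  have hapf' : cuspCoeff f' 2 = ((V.frobeniusTrace 2 : ℤ) : ℂ) := by
    rw [← hap]; exact cuspCoeff_eq_frobeniusTrace_of_isNewformOf_holds hfV' hordV'.1
  have hαeq2 : α ^ 2 - ((V.frobeniusTrace 2 : ℤ) : ℚ_[2]) * α + 2 = 0 := by exact_mod_cast hαeq
  have hαeq2' : α ^ 2 - ((V.frobeniusTrace 2 : ℤ) : ℚ_[2]) * α + 2 = 0 := by exact_mod_cast hαeq'
  have hdist₁ := fun n a ↦
    sum_fiber_msdMinusMeasure_succ_eq_of_coeffField (p := 2) hf hQ hN hapf hα0 hαeq n a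
  have hdist₂ := fun n a ↦
    sum_fiber_msdMinusMeasure_succ_eq_of_coeffField (p := 2) hf' hQ' hN' hapf' hα0 hαeq' n a
  obtain ⟨C₁', hC₁'⟩ := exists_norm_msdMinusMeasure_le_of_maninDrinfeld (p := 2)
    (exists_nsmul_modularSymbol_mem_periodLattice_of_isNewform0 hf hQ) hαu
  obtain ⟨C₂', hC₂'⟩ := exists_norm_msdMinusMeasure_le_of_maninDrinfeld (p := 2)
    (exists_nsmul_modularSymbol_mem_periodLattice_of_isNewform0 hf' hQ') hαu
  -- boundedness of the two odd branches and of their product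
  have hC₁ : ∀ k, ‖PowerSeries.coeff k B₁‖ ≤ C₁' := norm_coeff_padicLFunctionMinusBranch_le f α hdist₁ hC₁' 1
  have hC₂ : ∀ k, ‖PowerSeries.coeff k B₂‖ ≤ C₂' := norm_coeff_padicLFunctionMinusBranch_le f' α hdist₂ hC₂' 1
  have hM₁ : MemIwasawaRat 2 B₁ := memIwasawaRat_of_forall_norm_coeff_le hC₁
  have hM₂ : MemIwasawaRat 2 B₂ := memIwasawaRat_of_forall_norm_coeff_le hC₂
  have hMP : MemIwasawaRat 2 (B₁ * B₂) := memIwasawaRat_mul hM₁ hM₂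
  obtain ⟨CP, hCP⟩ := hMP.exists_norm_coeff_le
  -- the re-centred product `H(T) = P⁻(−2 − T)`
  obtain ⟨H, hHb, hH0, hH1, hHev⟩ := exists_recenter_sub hCP norm_neg_two_lt_one''
  refine ⟨H, ?_, hH0, hH1, fun z hz ↦ ?_⟩
  swap
  · have h := (hHev z hz).2
    rwa [algebraMap_neg_two''] at h
  -- `D := G − c⁻·H♯`
  obtain ⟨CG, hCG⟩ := hG.isLineFunction.1
  set D : PowerSeries ℂ_[2] := G - PowerSeries.C c * PowerSeries.map ι₂ H with hD
  have hDcoeff : ∀ i, PowerSeries.coeff i D = PowerSeries.coeff i G - c * ι₂ (PowerSeries.coeff i H) := by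
    intro i
    rw [hD, map_sub, PowerSeries.coeff_C_mul, PowerSeries.coeff_map]
  -- evaluation of `D` from evaluations of `G` and `H♯`
  have hDsum : ∀ (z vG vH : ℂ_[2]), HasSum (fun i ↦ PowerSeries.coeff i G * z ^ i) vG →
      HasSum (fun i ↦ ι₂ (PowerSeries.coeff i H) * z ^ i) vH →
      HasSum (fun i ↦ PowerSeries.coeff i D * z ^ i) (vG - c * vH) := by
    intro z vG vH hG' hH'
    have h := hG'.sub (hH'.mul_left c)
    refine h.congr_fun fun i ↦ ?_
    rw [hDcoeff, sub_mul, mul_assoc]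
  -- boundedness of `D`
  have hDb : ∀ i, ‖(RingHom.id ℂ_[2]) (PowerSeries.coeff i D)‖ ≤ CG + ‖c‖ * CP := by
    intro i
    rw [RingHom.id_apply, hDcoeff]
    refine (norm_sub_le _ _).trans (add_le_add (hCG i) ?_)
    rw [norm_mul, hι₂, norm_algebraMap']
    exact mul_le_mul_of_nonneg_left (hHb i) (norm_nonneg _)
  -- the constant terms of the odd branches: `α⁻²([1/4]⁻ − [3/4]⁻) = α⁻² Σ_b χ_{χ₄}(b)[b/4]⁻`
  have hB10 : ι₂ (PowerSeries.coeff 0 B₁) = ι₂ (α⁻¹ ^ 2) * ratMinusTwistedSymbolSum f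
      (((ZMod.χ₄.ringHomComp (Int.castRingHom ℂ) : DirichletCharacter ℂ (2 ^ 2))⁻¹.ringHomComp
        ι.symm.toRingHom).ringHomComp (algebraMap (PadicAlgCl 2) ℂ_[2])) := by
    rw [PowerSeries.coeff_zero_eq_constantCoeff, hB₁,
      constantCoeff_padicLFunctionMinusBranch_one_two_of_coeffField f hf hQ hN hapf hα0 hαeq2, map_mul,
      ratMinusTwistedSymbolSum_twin_chi4 ι f]
  have hB20 : ι₂ (PowerSeries.coeff 0 B₂) = ι₂ (α⁻¹ ^ 2) * ratMinusTwistedSymbolSum f'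
      (((ZMod.χ₄.ringHomComp (Int.castRingHom ℂ) : DirichletCharacter ℂ (2 ^ 2))⁻¹.ringHomComp
        ι.symm.toRingHom).ringHomComp (algebraMap (PadicAlgCl 2) ℂ_[2])) := by
    rw [PowerSeries.coeff_zero_eq_constantCoeff, hB₂,
      constantCoeff_padicLFunctionMinusBranch_one_two_of_coeffField f' hf' hQ' hN' hapf' hα0 hαeq2', map_mul,
      ratMinusTwistedSymbolSum_twin_chi4 ι f']
  -- the value of `H♯` at a point `z`: the product of the two odd-branch values at `−2 − z`
  have hHval : ∀ {z v₁ v₂ : ℂ_[2]}, ‖z‖ < 1 →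
      HasSum (fun k ↦ ι₂ (PowerSeries.coeff k B₁) * (-2 - z) ^ k) v₁ →
      HasSum (fun k ↦ ι₂ (PowerSeries.coeff k B₂) * (-2 - z) ^ k) v₂ →
      HasSum (fun i ↦ ι₂ (PowerSeries.coeff i H) * z ^ i) (v₁ * v₂) := by
    intro z v₁ v₂ hz hv₁ hv₂
    have hw : ‖(-2 - z : ℂ_[2])‖ < 1 := by
      rw [← algebraMap_neg_two'', sub_eq_add_neg]
      refine lt_of_le_of_lt (IsUltrametricDist.norm_add_le_max _ _) (max_lt ?_ (by rwa [norm_neg]))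
      rw [norm_algebraMap']; exact norm_neg_two_lt_one''
    have hprod := MemIwasawaRat.hasSum_eval_mul hM₁ hM₂ hw hv₁ hv₂
    have h := (hHev z hz).2
    rw [algebraMap_neg_two'', hprod.tsum_eq] at h
    exact h
  -- the even primitive character mod `8` on the MTT side: `χ₈`, point `−2`
  have he2 : cyclotomicExponent 2 ≤ 2 := by rw [cyclotomicExponent_two]
  have h4₃ : 4 ∣ 2 ^ (2 + 1) := by norm_num
  set χ₈₃ : DirichletCharacter ℂ (2 ^ (2 + 1)) := ZMod.χ₈.ringHomComp (Int.castRingHom ℂ) with hχ₈₃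
  have h8even : χ₈₃.Even := chi8_even
  have h8prim : χ₈₃.IsPrimitive := isPrimitive_χ₈_ringHomComp_of_charZero ℂ
  have hT8prim : DirichletCharacter.IsPrimitive
      ((χ₈₃⁻¹.ringHomComp ι.symm.toRingHom).ringHomComp (algebraMap (PadicAlgCl 2) ℂ_[2])) :=
    (twin_isPrimitive_iff ι χ₈₃).mpr h8prim
  have hT8even : DirichletCharacter.Even
      ((χ₈₃⁻¹.ringHomComp ι.symm.toRingHom).ringHomComp (algebraMap (PadicAlgCl 2) ℂ_[2])) :=
    (twin_even_iff ι χ₈₃).mpr h8even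
  have hT8ord : ∃ j : ℕ, orderOf
      ((χ₈₃⁻¹.ringHomComp ι.symm.toRingHom).ringHomComp (algebraMap (PadicAlgCl 2) ℂ_[2])) = 2 ^ j := by
    rw [orderOf_twin]; exact exists_orderOf_eq_two_pow χ₈₃
  have hpt8 : ((χ₈₃⁻¹.ringHomComp ι.symm.toRingHom).ringHomComp (algebraMap (PadicAlgCl 2) ℂ_[2]))
      (cyclotomicGenerator 2 : ZMod (2 ^ (2 + 1))) - 1 = -2 := by
    rw [twin_apply_cyclotomicGenerator_sub_one ι (m := 2) χ₈₃, hχ₈₃, cycLinePoint_chi8]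
  -- (a) the constant term: `G(0) = c⁻·v₈·v₈′ = c⁻·H(0)`
  have h0 : PowerSeries.constantCoeff D = 0 := by
    have hG0 := hasLineValueAt_chi8'Line_zero ι K h2 hsplit 𝔭 𝔭' h𝔭 h𝔭' κ hκ hκ2 hd hf hQ hf' hQ' hV' α hG
    have hv₁ := hasSum_padicLMinusBranchCoeff_mul_pow_of_isPrimitive f α hdist₁ hC₁' 1 he2 _ hT8prim
      hT8even hT8ord
    have hv₂ := hasSum_padicLMinusBranchCoeff_mul_pow_of_isPrimitive f' α hdist₂ hC₂' 1 he2 _ hT8prim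
      hT8even hT8ord
    simp only [← coeff_padicLFunctionMinusBranch] at hv₁ hv₂
    rw [sum_twin_mul_teichWeight_eq_ratMinusTwistedSymbolSum ι (he2.trans (Nat.le_succ 2)) h4₃ χ₈₃,
      ratMinusTwistedSymbolSum_twin_mul_chi4_of_level_eight ι h4₃ h8even h8prim, hpt8] at hv₁ hv₂
    have hv₁' : HasSum (fun k ↦ ι₂ (PowerSeries.coeff k B₁) * (-2 - (0 : ℂ_[2])) ^ k)
        (ι₂ (α⁻¹ ^ (2 + 1)) * ratMinusTwistedSymbolSum f
          (((ZMod.χ₈'.ringHomComp (Int.castRingHom ℂ) : DirichletCharacter ℂ (2 ^ (2 + 1)))⁻¹.ringHomComp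
            ι.symm.toRingHom).ringHomComp (algebraMap (PadicAlgCl 2) ℂ_[2]))) := by
      simpa only [sub_zero] using hv₁
    have hv₂' : HasSum (fun k ↦ ι₂ (PowerSeries.coeff k B₂) * (-2 - (0 : ℂ_[2])) ^ k)
        (ι₂ (α⁻¹ ^ (2 + 1)) * ratMinusTwistedSymbolSum f'
          (((ZMod.χ₈'.ringHomComp (Int.castRingHom ℂ) : DirichletCharacter ℂ (2 ^ (2 + 1)))⁻¹.ringHomComp
            ι.symm.toRingHom).ringHomComp (algebraMap (PadicAlgCl 2) ℂ_[2]))) := by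
      simpa only [sub_zero] using hv₂
    have hz0 : ‖(0 : ℂ_[2])‖ < 1 := by rw [norm_zero]; exact one_pos
    have hH' := hHval hz0 hv₁' hv₂'
    have hD0 := hDsum 0 _ _ hG0 hH'
    rw [mul_assoc c, sub_self] at hD0
    exact (HasLineValueAt.eq_constantCoeff hD0).symm
  -- (b) the characters of `Γ`
  have hchar : ∀ m : ℕ, 0 < m → ∀ χ : DirichletCharacter ℂ_[2] (2 ^ m), χ.IsPrimitive → χ.Even →
      (∃ j : ℕ, orderOf χ = 2 ^ j) →
        HasSum (fun i ↦ (RingHom.id ℂ_[2]) (PowerSeries.coeff i D) *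
          (χ (cyclotomicGenerator 2 : ZMod (2 ^ m)) - 1) ^ i) 0 := by
    intro m hm χ hχ heven hord
    simp only [RingHom.id_apply]
    obtain ⟨m', rfl⟩ := Nat.exists_eq_succ_of_ne_zero hm.ne'
    have hfin : IsOfFinOrder χ := by
      obtain ⟨j, hj⟩ := hord
      exact orderOf_pos_iff.mp (by rw [hj]; exact pow_pos two_pos j)
    obtain ⟨θ, rfl⟩ := exists_eq_twin_of_isOfFinOrder ι χ hfin
    have hθprim : θ.IsPrimitive := (twin_isPrimitive_iff ι θ).mp hχ
    have hθeven : θ.Even := (twin_even_iff ι θ).mp heven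
    rw [twin_apply_cyclotomicGenerator_sub_one ι θ]
    rcases Nat.lt_or_ge m' 3 with hlt | hge
    · interval_cases m'
      · -- level `2`: no primitive character
        exfalso
        rw [dirichletCharacter_level_two_eq_one θ, DirichletCharacter.isPrimitive_def,
          DirichletCharacter.conductor_one] at hθprim
        norm_num at hθprim
      · -- level `4`: no even primitive character
        exact absurd hθprim (not_isPrimitive_of_even_level_four θ hθeven)
      · -- level `8`: `θ = χ₈`, the point `T = −2`, line character `χ₄∘N`; `H(−2) = P⁻(0)`
        have hpt : cycLinePoint ι θ = -2 := by
          rw [eq_chi8_of_even_of_isPrimitive θ hθeven hθprim]; exact cycLinePoint_chi8 ι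
        rw [hpt]
        have hG2 := hasLineValueAt_chi8'Line_neg_two ι K h2 hsplit 𝔭 𝔭' h𝔭 h𝔭' κ hκ hκ2 hd hf hQ hf' hQ'
          hV' α hG hθeven hθprim
        have hz2 : ‖(-2 : ℂ_[2])‖ < 1 := by
          rw [← algebraMap_neg_two'', norm_algebraMap']; exact norm_neg_two_lt_one''
        have hB₁0 : HasSum (fun k ↦ ι₂ (PowerSeries.coeff k B₁) * (-2 - (-2 : ℂ_[2])) ^ k)
            (ι₂ (α⁻¹ ^ 2) * ratMinusTwistedSymbolSum f
              (((ZMod.χ₄.ringHomComp (Int.castRingHom ℂ) : DirichletCharacter ℂ (2 ^ 2))⁻¹.ringHomComp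
                ι.symm.toRingHom).ringHomComp (algebraMap (PadicAlgCl 2) ℂ_[2]))) := by
          rw [sub_neg_eq_add, neg_add_cancel, ← hB10]
          have h : HasSum (fun k ↦ ι₂ (PowerSeries.coeff k B₁) * (0 : ℂ_[2]) ^ k)
              (ι₂ (PowerSeries.coeff 0 B₁) * (0 : ℂ_[2]) ^ 0) :=
            hasSum_single 0 fun k hk ↦ by rw [zero_pow hk, mul_zero]
          rwa [pow_zero, mul_one] at h
        have hB₂0 : HasSum (fun k ↦ ι₂ (PowerSeries.coeff k B₂) * (-2 - (-2 : ℂ_[2])) ^ k)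
            (ι₂ (α⁻¹ ^ 2) * ratMinusTwistedSymbolSum f'
              (((ZMod.χ₄.ringHomComp (Int.castRingHom ℂ) : DirichletCharacter ℂ (2 ^ 2))⁻¹.ringHomComp
                ι.symm.toRingHom).ringHomComp (algebraMap (PadicAlgCl 2) ℂ_[2]))) := by
          rw [sub_neg_eq_add, neg_add_cancel, ← hB20]
          have h : HasSum (fun k ↦ ι₂ (PowerSeries.coeff k B₂) * (0 : ℂ_[2]) ^ k)
              (ι₂ (PowerSeries.coeff 0 B₂) * (0 : ℂ_[2]) ^ 0) :=
            hasSum_single 0 fun k hk ↦ by rw [zero_pow hk, mul_zero]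
          rwa [pow_zero, mul_one] at h
        have hH' := hHval hz2 hB₁0 hB₂0
        have hD2 := hDsum (-2) _ _ hG2 hH'
        rwa [mul_assoc c, sub_self] at hD2
    · -- level `2^{m'+1} ≥ 16`: `ξ = θχ₋₈ = (θχ₈)ω`; `G(pt θ) = c⁻·v·v′`, `H(pt θ) = P⁻(−pt θ − 2) = v·v′`
      have h8 : 8 ∣ 2 ^ (m' + 1) := by
        rw [show (8 : ℕ) = 2 ^ 3 by norm_num]; exact pow_dvd_pow 2 (by omega)
      have h4 : 4 ∣ 2 ^ (m' + 1) := by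
        rw [show (4 : ℕ) = 2 ^ 2 by norm_num]; exact pow_dvd_pow 2 (by omega)
      have he : cyclotomicExponent 2 ≤ m' := by rw [cyclotomicExponent_two]; omega
      have hGθ := hasLineValueAt_chi8'Line_of_three_le ι K h2 hsplit 𝔭 𝔭' h𝔭 h𝔭' κ hκ hκ2 hd hf hQ hf'
        hQ' hV' α hG hge h8 hθeven hθprim
      -- the odd branches at the twin of `θχ₈`, whose point is `−pt θ − 2`
      have hξprim : DirichletCharacter.IsPrimitive
          (((θ * DirichletCharacter.changeLevel h8 (ZMod.χ₈.ringHomComp (Int.castRingHom ℂ)))⁻¹.ringHomComp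
            ι.symm.toRingHom).ringHomComp (algebraMap (PadicAlgCl 2) ℂ_[2])) :=
        (twin_isPrimitive_iff ι _).mpr (isPrimitive_mul_chi8_changeLevel hge h8 hθprim)
      have hξeven : DirichletCharacter.Even
          (((θ * DirichletCharacter.changeLevel h8 (ZMod.χ₈.ringHomComp (Int.castRingHom ℂ)))⁻¹.ringHomComp
            ι.symm.toRingHom).ringHomComp (algebraMap (PadicAlgCl 2) ℂ_[2])) :=
        (twin_even_iff ι _).mpr (even_mul_chi8_changeLevel h8 hθeven)
      have hξord : ∃ j : ℕ, orderOf
          (((θ * DirichletCharacter.changeLevel h8 (ZMod.χ₈.ringHomComp (Int.castRingHom ℂ)))⁻¹.ringHomComp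
            ι.symm.toRingHom).ringHomComp (algebraMap (PadicAlgCl 2) ℂ_[2])) = 2 ^ j := by
        rw [orderOf_twin]; exact exists_orderOf_eq_two_pow _
      have hptξ : (((θ * DirichletCharacter.changeLevel h8 (ZMod.χ₈.ringHomComp (Int.castRingHom ℂ)))⁻¹.ringHomComp
            ι.symm.toRingHom).ringHomComp (algebraMap (PadicAlgCl 2) ℂ_[2]))
          (cyclotomicGenerator 2 : ZMod (2 ^ (m' + 1))) - 1 = -2 - cycLinePoint ι θ := by
        rw [twin_apply_cyclotomicGenerator_sub_one ι _, cycLinePoint_mul_chi8 ι h8 θ]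
        ring
      have hv₁ := hasSum_padicLMinusBranchCoeff_mul_pow_of_isPrimitive f α hdist₁ hC₁' 1 he _ hξprim
        hξeven hξord
      have hv₂ := hasSum_padicLMinusBranchCoeff_mul_pow_of_isPrimitive f' α hdist₂ hC₂' 1 he _ hξprim
        hξeven hξord
      simp only [← coeff_padicLFunctionMinusBranch] at hv₁ hv₂
      rw [sum_twin_mul_teichWeight_eq_ratMinusTwistedSymbolSum ι (he.trans (Nat.le_succ _)) h4 _,
        mul_chi8_changeLevel_mul_chi4_changeLevel h8 h4 θ, hptξ] at hv₁ hv₂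
      have hzθ : ‖cycLinePoint ι θ‖ < 1 := by
        rw [← twin_apply_cyclotomicGenerator_sub_one ι θ]
        exact norm_apply_cyclotomicGenerator_sub_one_lt _ hord
      have hH' := hHval hzθ hv₁ hv₂
      have hDθ := hDsum _ _ _ hGθ hH'
      rwa [mul_assoc c, sub_self] at hDθ
  -- uniqueness
  have hD0 : D = 0 :=
    eq_zero_of_bounded_of_forall_character_hasSum_zero (RingHom.id ℂ_[2]) (fun _ _ h ↦ h) hDb h0 hchar
  rw [hD, sub_eq_zero] at hD0
  exact hD0

end FactorisationMinusEight

end Summit.BirchSwinnertonDyer.BirchSwinnertonDyer.Theorems.PrintCf2.DisegniPairTwo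

end
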